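import Mathlib
import HarnessLib
import HarnessLib.Audit
import Summits.HubbardSuperconductivity.Statement
import Literature.MathematicalPhysics.QuantumLattice.HubbardRingPerronFrobeniusProofs

/-!
Route: PlateauExclusion

CLOSED (retired) 2026-08-16T03:24:11Z by planner-rchoice-HubbardSuperconductivity-Plate-b96f210c-0 — reason: route-choice (operator hold target-unreachable, 2026-08-16T02:56:59Z): retired — target X=UniversalPairIncompressibility is universal in (U,δ), reached by no crux and expected false wherever a pair condensate exists (Anderson tower L²Δ₂→4/κ — note: route-choice (operator hold target-unreachable, 2026-08-16T02:56:59Z): RETIRED. Census: the deciding theorem closes ¬S only through the universal target X = UniversalPairIncompressibility (∀U>0 ∀δ∈(0,1/2) limsup_{L even} L²Δ₂(N_L;L)=+∞), reached by no crux; any closes-hypothesis of this engine must . The file is kept as the record of this route; refuted decls are indexed as negative knowledge (`ledger negatives`).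

NEGATIVE SIDE (card plateau-exclusion-koma-tasaki). Thesis X = UniversalPairIncompressibility: "for
every U > 0 and every hole doping δ ∈ (0, 1/2) the pure t'=0 Hubbard model is PAIR-INCOMPRESSIBLE
along even tori: limsup_{L even} L² · Δ₂(N_L; L) = +∞, where Δ₂(N; L) = E₀(N+2, S^z=0) + E₀(N−2, 0)
− 2 E₀(N, 0) is the canonical pair charge gap of hubbardTorus 2 L 1 U (sector minima
`Matrix.minEnergyOn (szSector · 0)`) and N_L = 2⌊(1−δ)L²/2⌋". It suffices for
¬HubbardSuperconductivity because of the route's engine, a μ-free bond-pair-field form of the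
Koma–Tasaki/Horsch–von der Linden double-commutator theorem (tree: LROForcesLowLyingStates_holds):
for every normalised (N, S^z=0) sector ground state ψ_L, Δ₂(N; L) · ⟨ψ_L, Δ_d†Δ_d ψ_L⟩ ≤ C(U) · L²
(engine PairGapCeiling, support r2); hence d-wave pair-field LRO (⟨Δ_d†Δ_d⟩ ≥ m²L⁴ eventually along
even L) forces Δ₂ ≤ C/(m²L²), and pair-incompressibility at (U, δ) excludes LRO for EVERY admissible
ground-state sequence there (schema IncompressibilityExcludesPairing). Honest prior, stated plainly
as for the sibling refutation routes NoGo / AbsenceCertificate / CoboundaryCeiling: X is expected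
FALSE at weak coupling (a Kohn–Luttinger d-wave state is pair-compressible; refuter evidence
SUSPECT-1806; provers do not attempt X); the route's value is REGIONAL and INSTRUMENTAL — at the
filled-stripe lock-in (U, δ) = (8, 1/8) the O(1) canonical pair plateau along commensurate sides L =
8k (crux StripePlateau, r3) or already its load-bearing minimum, unbounded L²Δ₂ along some even
sides (crux StripePointIncompressibility, r4 = X at (8, 1/8)), turns the catalogued numerical no-go
¬HasDWavePairFieldLROAt 8 (1/8) into a theorem target (support StripePointExclusion), and the engine
is a certified necessary condition (pair compressibility) that every S-side witness must meet.
Lean (target, elaborates): ∀ (U δ : ℝ), 0 < U → δ ∈ Set.Ioo (0:ℝ) (1 / 2) → ∀ (C : ℝ) (k₀ : ℕ), ∃ k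
: ℕ, k₀ ≤ k ∧ ∀ n : ℕ, n = 2 * ⌊(1 - δ) * ((2 * k : ℕ) : ℝ) ^ 2 / 2⌋₊ → C ≤ ((2 * k : ℕ) : ℝ) ^ 2 *
(E(n+2) + E(n-2) - 2 E(n)) with E(m) := (hubbardTorus 2 (2 * k) 1 U).minEnergyOn (szSector m 0).
## Assembly
Deciding theorem (glue.lean, sorry-free; lean check rc 0 in the planner's Sketch.lean, rev 3):
`theorem closes (h_schema : IncompressibilityExcludesPairing) (h_X : UniversalPairIncompressibility)
: ¬ HubbardSuperconductivity` — unfold the summit to its witness (U, δ) at which EVERY admissible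
sequence has LRO, apply the schema at (U, δ) to X's incompressibility to get that NO admissible
sequence has LRO, and exhibit one admissible sequence (normalised (N_L, S^z=0)-sector ground states
exist at every side: szSector_groundState + exists_smul_unit, imported from
Literature.MathematicalPhysics.QuantumLattice.HubbardRingPerronFrobeniusProofs). The Assembly item
(PairGapCeiling → IncompressibilityExcludesPairing → X → ¬S) is kept as the displayed chain and is
now a one-line corollary of `closes`. Off-chain (regional layer, both glue steps proved in
Sketch.lean, to be filed by provers with --supports): StripePlateau → StripePointIncompressibility
(k := 4k′) and IncompressibilityExcludesPairing → StripePointIncompressibility →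
StripePointExclusion. ROUTE REPAIR (rev 3, 2026-08-15, route-repair g2): (i) cone —
StripePointExclusion restated INLINE as the negated summit matrix at (8, 1/8) (¬ ∀ admissible (N, ψ)
at U = 8, δ = 1/8, even-side d-wave LRO), the same Prop as ¬HasDWavePairFieldLROAt 8 (1/8) = the
barrier headline PureModelStripeCompetition (both Iff.rfl, checked in Sketch2.lean) but no longer
USING that registered open-conjecture constant, which had put un-dischargeable named-fact debt into
the route's dependency cone, and the route file no longer imports
Literature.Barriers.HubbardSuperconductivity.PureModelStripeCompetition (1 import dropped;
Literature.MathematicalPhysics.QuantumLattice.HubbardRingPerronFrobeniusProofs added for `closes`);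
PROVERS: Theorems files for this route must not use PureModelStripeCompetition /
PureModelStripeCompetitionRange (they would re-enter the cone) — spell the type out as the item
does; (ii) crux floor — StripePointIncompressibility added (r4); (iii) glue — `closes` supplied
(refutation direction).

Rationale: WHY THIS LINE. PROBLEMS.md §3 asks for a "Koma–Tasaki-type" refutation; at T = 0 no Mermin–Wagner
no-go exists (KLS-type ground states order), but the tree's PROVED tower-of-states theorem
(KomaTasaki1994 Thm 2.2 = LROForcesLowLyingStates_holds, HorschVonDerLinden1988) read BACKWARDS is a
T = 0 exclusion engine conditional on one thermodynamic datum: pair LRO in a number eigenstate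
forces the pair-addition/removal energies to meet within O(L⁻²). Route NoGo dismissed this ("no
charge gap at 0 < δ"); the point of this route is that the relevant gap is the CANONICAL
finite-torus pair gap Δ₂(N_L; L) at fixed stripe count, which for a filled-stripe crystal is a
defect energy O(1) along commensurate sides L = 8k even though the infinite-volume stripe array is
compressible through its wavelength (ZhengEtAl2017 p.5–6: λ = 5–8 nearly degenerate, minimum at the
filled λ = 8 for U = 6, 8, 12; XuEtAl2022: charge wavelength 1/δ = filled stripes up to δ ≈ 1/5;
QinEtAl2020 App. C Fig. 17: holes enter stripes in PAIRS with μ-steps on 16×4/64×4, t' = 0, U = 8).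
Imported areas: finite-size spectral theory of order parameters (KT), stripe phenomenology (numerics
as evidence only), the dimer/four-matching split of the d-wave pair operator (SuSuzuki1998 fn. 23)
to reuse the commuting-density theorem.
DERIVATION (engine, μ-free). O = Δ_d + Δ_d†, Hψ = Eψ ⇒ ⟨Oψ,(H−E)Oψ⟩ = ½⟨ψ,[[O,H],O]ψ⟩ ≤ ½‖[[O,H],O]‖
≤ C_R(U)L² (locality). Sector split (N±2 orthogonal): a·x + b·y ≤ C_R L² with a = E₀(N+2)−E₀(N), b =
E₀(N−2)−E₀(N), y = ‖Δ_dψ‖² = ⟨Δ_d†Δ_d⟩, x = ‖Δ_d†ψ‖² = y + ⟨[Δ_d,Δ_d†]⟩, |⟨[Δ_d,Δ_d†]⟩| ≤ C_d L²; so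
Δ₂·y ≤ (C_R + |a|C_d)L² and |a| ≤ 8 + 2|U| by the one-particle AffinityBound (average Rayleigh
quotients of c†_{xσ}ψ over x: numerator −⟨T̂_σ⟩ + U⟨Σ n_{x,−σ}(1−n_{xσ})⟩ ≤ (4+U⁺)(L²−N_σ)). The
card's chemical-potential choice is unnecessary (μ cancels). Explicit C(U) ≈ 10⁵(4+U): the ceiling
is ASYMPTOTIC, useless at ED sizes — refuters should not expect 4×4 certificates from it.
RANKED CRUXES. #3 StripePlateau (crux) — the physics bet: ∃ w > 0, Δ₂(56k²; 8k) ≥ w at U = 8 for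
large k (k filled period-8 stripes on the 8k-torus; plateau ⇔ cusp of the stripe energy at filling
1, i.e. insulating domain walls) (why it might fail: filled λ = 8 beats d-wave-paired λ = 5–7
stripes only by 5e-4–4e-3 t/site, ZhengEtAl2017; VAFQMC has metallic W = 7 stripes / uniform d-wave
within 1e-3 t, Sorella2023 Fig. 4, 9). #4 StripePointIncompressibility (crux, added rev 3) — the
load-bearing regional MINIMUM, X instantiated at (8, 1/8): limsup over even L of L²Δ₂(N_L; L) = +∞
(∀ C k₀ ∃ k ≥ k₀: (2k)²Δ₂(N_{2k}; 2k) ≥ C at U = 8, δ = 1/8) — exactly what the schema consumes at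
the stripe point; implied by StripePlateau (k := 4k′) but strictly weaker: an O(1) plateau is not
needed, a transversely locked stripe array that is metallic ALONG the stripes (smectic metal,
EmeryEtAl2000 = Emery–Fradkin–Kivelson–Lubensky, PRL 85 (2000) 2160) still has Δ₂ ≳ v/L at closed 1D
shells, so L²Δ₂ → ∞ along a subsequence (why it might fail: pair-level compressibility of the (8,
1/8) ground state along all large even L — striped or uniform d-wave superconductor with
inter-stripe pair tunnelling, Sorella2023 Fig. 4/9, or phase separation). SUPPORT: r2 PairGapCeiling
— the engine (retriaged crux → support 2026-08-15: a theorem on paper — double commutator + N±2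
sector split + AffinityBound — the hardest honest Lean work: CAR algebra of bond pairs, locality
norm bounds or horschVonDerLinden_holds on four dimer sublattices); IncompressibilityExcludesPairing
(schema = engine + liminf bookkeeping); StripePointExclusion = the negated summit matrix at (8,
1/8), spelled out (restated rev 3; Iff.rfl-equal to ¬HasDWavePairFieldLROAt 8 (1/8) and to the
barrier headline PureModelStripeCompetition, whose constant and module the route no longer uses;
reached by schema + #4, glue proved in Sketch.lean); AffinityBound; Assembly (corollary of
`closes`); and the target X (global closure, expected false, provers do not attempt it —
SUSPECT-1806).
KILL CRITERIA. StripePointIncompressibility refuted (a theorem bounding L²Δ₂(N_L; L) at (8, 1/8)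
along all large even L) ⇒ the regional payoff is gone and with it the route: close
refuted:StripePointIncompressibility (engine items survive as shared support). StripePlateau refuted
or flagged suspect-false by evidence (published/kit DMRG equation of state n(μ) of the t' = 0, U = 8
model with NO μ-plateau at n = 7/8 on width ≥ 6, or a torus computation showing Δ₂(56k²; 8k) → 0)
while #4 stands ⇒ drop #3, keep #4, restate once toward the smectic reading or as ∃ U ∈ [8, 16]
(filled stripes harden with U, ZhengEtAl2017 p.6); PairGapCeiling refuted (it is a theorem on paper
— a refutation would expose a typing error: restate); any proof of HasDWavePairFieldLROAt U δ
anywhere kills X (route closes refuted:UniversalPairIncompressibility, regional items survive as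
shared statements); WeakCouplingBCS cruxes proved ⇒ same.
NOT DECOMPOSED YET. The filled-stripe fan δ = 1/q, q = 5…12, U ≥ 8 (family version of #3/#4, one
more regional point each; deliberately not filed: same mechanism, no new information until #3 or #4
moves); the abstract locality variant of KT Thm 2.2 as a Literature fact; the devil's-staircase
window remark of the card (pointwise bookkeeping given the schema); certified-ED calibration at L =
4 (uninformative, see constants); how X could ever hold at weak coupling (it should not).
CHEAPEST FALSIFIER. The width-≥6 equation of state: a published or kit DMRG/AFQMC n(μ) curve of the
PURE t' = 0, U = 8 model on width ≥ 6 cylinders (or a 16×16 torus estimate of Δ₂(224; 16)) showing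
NO μ-plateau / pair-compressible response at n = 7/8 kills #3 outright and makes #4 implausible;
QinEtAl2020 App. C Fig. 17 (μ-steps, holes entering in pairs on 16×4 and 64×4) is the width-4
evidence for the plateau, Sorella2023 Fig. 4/9 the evidence against.
TWO-LAYER PLAN. #3 → #4 (k := 4k′, proved in Sketch.lean:
stripePointIncompressibility_of_stripePlateau); IncompressibilityExcludesPairing → #4 →
StripePointExclusion (proved ibid.: stripePointExclusion_of, needs only existence of admissible
sequences); PairGapCeiling → IncompressibilityExcludesPairing (liminf bookkeeping, grounder pointer:
EvenTorusBookkeeping script on stmt-HubbardSuperconductivity-1668); AffinityBound → (|a| ≤ 8 + 2|U|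
inside PairGapCeiling). No further items until #3 or #4 closes.
PRIOR-PROGRAMME NOTES: not read (plancard mode; card-driven).

Novelty: Nearest prior art (searched: tree barrier files LROForcesLowLyingStates/PureModelStripeCompetition,
route NoGo header, lit read arXiv:cond-mat/9708132 pp.7,15, arXiv:cond-mat/9801243 pp.4,6-7,10,
arXiv:1701.00054 pp.5-6, arXiv:1910.08931 pp.7,16, arXiv:2112.02187 pp.1,6; lit frontier/bridges
HubbardSuperconductivity; the card's refuter novelty audit): the QUALITATIVE contrapositive "charge
gap ⇒ no d_{x²-y²} pairing LRO at T=0, any filling, either sign of U" is published — SuSuzuki1998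
(PRB 58:117, p.6-7, Bogoliubov inequality with β/2 → 1/E_gap; fn. 23: four-term split of the d-wave
operator), ancestors Landau–Perez–Wreszinski 1981 / Momoi 1996; the finite-volume quantitative form
is KomaTasaki1994 Thm 2.2 (c₀ = 2r²hμ⁻², proved in tree) with §3.4 on pairing; stripe
incompressibility phenomenology ZhengEtAl2017, QinEtAl2020, XuEtAl2022. DELTA (new-combination, as
graded on the card): (i) a μ-free, sector-resolved finite-torus ceiling Δ₂(N;L)·⟨Δ_d†Δ_d⟩ ≤ C(U)L²
stated in Lean over the summit's own objects (minEnergyOn/szSector), whose proof needs the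
one-particle affinity lemma rather than a chemical potential; (ii) its use as a REGIONAL exclusion
schema aimed at the canonical pair gap of commensurate filled-stripe lock-ins (L = 8k at δ = 1/8),
which is O(1) for a stripe crystal even where the infinite-volume array is wavelength-compressible —
contradicting NoGo's recorded dismissal; (iii) the catalogued numerical no-go
PureModelStripeCompetition becomes a conditional theorem  [refs: cond-mat/9708132, cond-mat/9801243, 1701.00054, 1910.08931, 2112.02187, SuSuzuki1998, KomaTasaki1994, ZhengEtAl2017, QinEtAl2020, XuEtAl2022]

Barriers (technique_class: negative-side regional-exclusion incompressibility KT): technique_class: negative-side regional-exclusion incompressibility KT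
- Literature.Barriers.HubbardSuperconductivity.LROForcesLowLyingStates: this IS the engine, used
contrapositively and with its scope caveat respected — the low-lying state lives in the N±2 sectors,
so the conclusion is about the PAIR charge gap Δ₂ (sector minima at N±2 vs N), never about an
intra-sector gap; the commuting-density hypothesis (hoo) is evaded by the four-matching split of Δ_d
or a locality variant.
- Literature.Barriers.HubbardSuperconductivity.PureModelStripeCompetition: not fought but sharpened
— its headline ¬HasDWavePairFieldLROAt 8 (1/8) is this route's support item StripePointExclusion,
reduced (glue proved) to the falsifiable finite-size statement StripePlateau; the barrier's
'contested' status (Sorella2023 vs QinEtAl2020/XuEtAl2024) is that crux's why-might-fail.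
- Literature.Barriers.HubbardSuperconductivity.SignProblemNPHard: applies to any attempt to certify
StripePlateau by QMC — it cannot; numerics stay evidence, the plateau stays a crux until a proof
exists.
- Literature.Barriers.HubbardSuperconductivity.StrongCouplingCeiling: applies to proving stripe
crystallisation/plateaus by t/U or atomic-limit expansions of the SU(2) model (gapless spins defeat
quantum Pirogov–Sinai) — NOT evaded; the bet is only that a charge plateau is a softer thermodynamic
statement than full phase control; the engine itself is expansion-free.
- Literature.Barriers.HubbardSuperconductivity.WeakCoupling

Novelty grade: new-combination — Route review grade (refuter, 2026-08-15). Search this session: crossref 'charge gap absence of superconducting long-range order ground state Hubbard' (Su–Schadschneider–Zittartz 1997 PLA, Su–Suzuki 1998 = the published qualitative contrapositive; nothing stating a μ-free sector-resolved finite-torus (refuter refuter-rreview-route-AnomalousDissipati-218e94b9-0, 2026-08-15T11:21:07Z; prior: KomaTasaki1994 Thm 2.2 / HorschVonDerLinden1988 (tree: LROForcesLowLyingStates_holds, horschVonDerLinden_holds) — the engine read contrapositively, SuSuzuki1998 doi:10.1103/PhysRevB.58.117 (charge gap ⇒ no d-wave pairing LRO at T=0; fn.23 four-matching split); Su–Schadschneider–Zittartz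 1997 doi:10.1016/s0375-9601(97)00204-1, arXiv:1701.00054 ZhengEtAl2017, arXiv:1910.08931 QinEtAl2020, arXiv:2112)

History (route lifecycle, newest last):
- 2026-08-15T16:34:51Z · rev 2: restated StripePointExclusion (stmt-HubbardSuperconductivity-1810) — route-repair (rbadge g2, 2026-08-15): (i) CONE — restate StripePointExclusion inline (negated summit matrix at (8,1/8); Iff.rfl-equal to ¬HasDWavePairFieldLROAt (planner-rbadge-HubbardSuperconductivity-Platea-b4660fa7-g2-0)
- 2026-08-16T03:24:11Z · CLOSED retired — route-choice (operator hold target-unreachable, 2026-08-16T02:56:59Z): retired — target X=UniversalPairIncompressibility is universal in (U,δ), reached by no crux and expected false wherever a pair co (planner-rchoice-HubbardSuperconductivity-Plate-b96f210c-0)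

sub-problem: HubbardSuperconductivity · status: closed(retired) · opened planner-plancard-HubbardSuperconductivity-Hub-d56d1d6a-0 2026-08-15T10:58:59Z · rev 3 · ledger route-HubbardSuperconductivity-PlateauExclusion
GENERATED by the gate from the ledger (D-0016/17). Provers cite these decls: `theorem foo : Summit.HubbardSuperconductivity.HubbardSuperconductivity.Theses.PlateauExclusion.<Decl> := …` in Summits/HubbardSuperconductivity/HubbardSuperconductivity/Theorems/<Name>.lean.
-/

namespace Summit.HubbardSuperconductivity.HubbardSuperconductivity.Theses.PlateauExclusion

open scoped BigOperators Topology Manifold Classical MeasureTheory ProbabilityTheory Matrix InnerProductSpace ComplexConjugate ContinuousMap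
open Filter Set Function TopologicalSpace MeasureTheory

attribute [summit_statement] _root_.HubbardSuperconductivity

open Literature.Hubbard

/-- item stmt-HubbardSuperconductivity-1806 · target · rank 0 · closed · moot by None · by planner
why it might fail: Universal over (U,δ), implied by no crux; any pair-compressible ground state — weak-coupling Kohn–Luttinger/BCS d-wave (RaghuKivelsonScalapino2010, DengEtAl2015), uniform d-wave or metallic W=7 stripes at U=8 (Sorella2023 Fig.4) — has L²Δ₂=O(1), limsup<∞; false wherever S holds (SUSPECT-1806).
sources: RaghuKivelsonScalapino2010, DengEtAl2015, Sorella2023, SuSuzuki1998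
[target] X: for every U > 0 and δ ∈ (0,1/2) the pure t'=0 model is pair-incompressible along even
tori: limsup_{L even} L²·Δ₂(N_L;L) = +∞, with Δ₂(N;L) = E₀(N+2,S^z=0) + E₀(N−2,0) − 2E₀(N,0) the
canonical pair charge gap (sector minima Matrix.minEnergyOn (szSector · 0) of hubbardTorus 2 L 1 U)
and N_L = 2⌊(1−δ)L²/2⌋ (written '∀ n, n = formula →' so that instances are syntactic). With the
schema IncompressibilityExcludesPairing (from the engine PairGapCeiling) X ⇒
¬HubbardSuperconductivity (Assembly, proved by the planner modulo its hypotheses). HONEST PRIOR: X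
is expected FALSE at weak coupling — a Kohn–Luttinger d-wave ground state is compressible, Δ₂ ≈
4/(κL²) (RaghuKivelsonScalapino2010; DengEtAl2015); the route's value is regional (StripePlateau ⇒
StripePointExclusion) and as a certified necessary condition (pair compressibility) for every S-side
witness. Any proof of HasDWavePairFieldLROAt U δ at one point refutes X. -/
@[route_item "route-HubbardSuperconductivity-PlateauExclusion"]
def UniversalPairIncompressibility : Prop :=
  ∀ (U δ : ℝ), 0 < U → δ ∈ Set.Ioo (0:ℝ) (1 / 2) → ∀ (C : ℝ) (k₀ : ℕ), ∃ k : ℕ, k₀ ≤ k ∧ ∀ n : ℕ, n = 2 * ⌊(1 - δ) * ((2 * k : ℕ) : ℝ) ^ 2 / 2⌋₊ → C ≤ ((2 * k : ℕ) : ℝ) ^ 2 * ((Literature.MathematicalPhysics.QuantumLattice.hubbardTorus 2 (2 * k) 1 U).minEnergyOn (Literature.MathematicalPhysics.QuantumLattice.szSector (n + 2) 0) + (Literature.MathematicalPhysics.QuantumLattice.hubbardTorus 2 (2 * k) 1 U).minEnergyOn (Literature.MathematicalPhysics.QuantumLattice.szSector (n - 2) 0) - 2 * (Literature.MathematicalPhysics.QuantumLattice.hubbardTorus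 2 (2 * k) 1 U).minEnergyOn (Literature.MathematicalPhysics.QuantumLattice.szSector n 0))

/-- item stmt-HubbardSuperconductivity-1808 · crux · rank 3 · closed · moot by None · by planner
why it might fail: At (8,1/8) the filled λ=8 crystal beats partially filled, d-wave-paired λ=5–7 stripes by 5e-4–4e-3 t/site (ZhengEtAl2017 p.5–6); VAFQMC finds metallic W=7 stripes/uniform d-wave lowest within 1e-3t (Sorella2023 Fig.4,9) ⇒ Δ₂=O(L⁻²) on large tori; needs insulating walls (arXiv:1905.02658: yes).
sources: ZhengEtAl2017, Sorella2023, TocchioMontorsiBecca2019, arXiv:1905.02658, QinEtAl2020, XuEtAl2022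
[crux] THE BET (filled-stripe pair plateau at the catalogued stripe point): at U = 8, δ = 1/8, along
the commensurate even sides L = 8k the canonical pair charge gap stays open: ∃ w > 0 ∃ k₀ ∀ k ≥ k₀,
Δ₂(56k²; 8k) = E₀(56k²+2,0) + E₀(56k²−2,0) − 2E₀(56k²,0) ≥ w (N = 2⌊(7/8)(8k)²/2⌋ = 56k²: 8k² holes
= k filled vertical stripes of period 8 and length 8k). Physics: with the stripe COUNT pinned by the
torus, N → N±2 cannot change the wavelength, so Δ₂ is a defect (kink/interstitial) energy; it is
O(1) iff the stripe energy per unit length has a cusp at filling 1 (insulating domain wall, as for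
Hartree–Fock filled stripes and the 'commensurate unidirectional CDW insulating state … full
stripes' reading of t'=0 four-leg data, ArovasBergKivelsonRaghu2022 §6 p.25); the wavelength
near-degeneracy (λ = 5–8 within 5·10⁻⁴–4·10⁻³ t/site, minimum at filled λ = 8 for U = 6, 8, 12:
ZhengEtAl2017 pp.5–6) is a DIFFERENT direction and does not close Δ₂ at fixed L; holes enter stripes
in pairs with visible μ-steps on 16×4 and 64×4 t'=0 cylinders at U = 8 (QinEtAl2020 App. C Figs.
16–17, p.16); charge wavelength 1/δ (filled) throughout the stripe/SDW fan up to δ ≈ 1/5 (XuEtAl2022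
abstract, p.6). Evide -/
@[route_item "route-HubbardSuperconductivity-PlateauExclusion"]
def StripePlateau : Prop :=
  ∃ w : ℝ, 0 < w ∧ ∃ k₀ : ℕ, ∀ k : ℕ, k₀ ≤ k → ∀ n : ℕ, n = 2 * ⌊(1 - 1 / 8) * ((2 * (4 * k) : ℕ) : ℝ) ^ 2 / 2⌋₊ → w ≤ (Literature.MathematicalPhysics.QuantumLattice.hubbardTorus 2 (2 * (4 * k)) 1 8).minEnergyOn (Literature.MathematicalPhysics.QuantumLattice.szSector (n + 2) 0) + (Literature.MathematicalPhysics.QuantumLattice.hubbardTorus 2 (2 * (4 * k)) 1 8).minEnergyOn (Literature.MathematicalPhysics.QuantumLattice.szSector (n - 2) 0) - 2 * (Literature.MathematicalPhysics.QuantumLattice.hubbardTorus 2 (2 * (4 * k)) 1 8).minEnergyOn (Literature.MathematicalPhysics.QuantumLattice.szSector n 0)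

/-- item stmt-HubbardSuperconductivity-10963 · crux · rank 4 · closed · moot by None · by planner
why it might fail: Fails iff the (8,1/8) ground state is pair-compressible (L²Δ₂ bounded) along all large even L: striped/uniform d-wave SC within ~1e-3t of the filled stripe (Sorella2023 Fig.4,9), smectic pair tunnelling (EmeryEtAl2000) or phase separation; only insulating filled stripes (QinEtAl2020) save it.
sources: Sorella2023, QinEtAl2020, ZhengEtAl2017, EmeryEtAl2000, arXiv:1905.02658, XuEtAl2022
[crux] STRIPE-POINT PAIR INCOMPRESSIBILITY — the load-bearing regional minimum, i.e. the target X
instantiated at (U, δ) = (8, 1/8): limsup over even sides L of L²·Δ₂(N_L; L) = +∞ for the canonical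
pair charge gap Δ₂(N; L) = E₀(N+2, S^z=0) + E₀(N−2, 0) − 2E₀(N, 0) of hubbardTorus 2 L 1 8 (sector
minima Matrix.minEnergyOn (szSector · 0)) at N_L = 2⌊(7/8)L²/2⌋ — written, like X, as ∀ C k₀ ∃ k ≥
k₀ ∀ n = N_{2k}: C ≤ (2k)²Δ₂(n; 2k) (n ≥ 2 automatic for k ≥ 1). It is exactly the hypothesis the
schema IncompressibilityExcludesPairing consumes at the stripe point, so
IncompressibilityExcludesPairing → this → StripePointExclusion (glue `stripePointExclusion_of`
proved in the planner's Sketch.lean; needs only existence of admissible sequences,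
szSector_groundState), and StripePlateau → this (k := 4k′;
`stripePointIncompressibility_of_stripePlateau`, ibid.). Strictly WEAKER than StripePlateau: an O(1)
plateau is not needed — a transversely locked stripe array that is metallic ALONG the stripes (the
smectic-metal scenario, EmeryEtAl2000) has Δ₂ of order v/L at closed 1D shells, still L²Δ₂ → ∞ along
a subsequence of even sides; what kills it is PAIR-LEVEL compressibility of the (8, 1/8) ground -/
@[route_item "route-HubbardSuperconductivity-PlateauExclusion"]
def StripePointIncompressibility : Prop :=
  ∀ (C : ℝ) (k₀ : ℕ), ∃ k : ℕ, k₀ ≤ k ∧ ∀ n : ℕ, n = 2 * ⌊(1 - 1 / 8) * ((2 * k : ℕ) : ℝ) ^ 2 / 2⌋₊ → C ≤ ((2 * k : ℕ) : ℝ) ^ 2 * ((Literature.MathematicalPhysics.QuantumLattice.hubbardTorus 2 (2 * k) 1 8).minEnergyOn (Literature.MathematicalPhysics.QuantumLattice.szSector (n + 2) 0) + (Literature.MathematicalPhysics.QuantumLattice.hubbardTorus 2 (2 * k) 1 8).minEnergyOn (Literature.MathematicalPhysics.QuantumLattice.szSector (n - 2) 0) - 2 * (Literature.MathematicalPhysics.QuantumLattice.hubbardTorus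 2 (2 * k) 1 8).minEnergyOn (Literature.MathematicalPhysics.QuantumLattice.szSector n 0))

/-- item stmt-HubbardSuperconductivity-1807 · support · rank 2 · closed · moot by None · by planner
why it might fail: Bond pair densities do not commute (KT's hoo): needs the four-matching split or a locality recount; the μ-free sector split needs |E₀(N±2)−E₀(N)| ≤ 8+2|U| (AffinityBound) and ⟨[Δ_d,Δ_d†]⟩ = O(L²); empty-sector junk of minEnergyOn is fenced by 2 ≤ N ≤ 2L²−2 (a mis-fence breaks ∃C only via typing).
sources: KomaTasaki1994, HorschVonDerLinden1988, SuSuzuki1998, Tasaki2019Tower, Literature.MathematicalPhysics.QuantumLattice.KomaTasaki.horschVonDerLinden_holds, Literature.Barriers.HubbardSuperconductivity.LROForcesLowLyingStates_holds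
[crux] ENGINE (Koma–Tasaki/Horsch–von der Linden double commutator, bond-pair-field form, μ-free):
for every U there is C(U) such that for every even side L, every N with 2 ≤ N ≤ 2L²−2 and every
normalised ground state ψ of hubbardTorus 2 L 1 U in the (N, S^z=0) sector, Δ₂(N;L) · re⟨ψ, Δ_d†Δ_d
ψ⟩ ≤ C·L², where Δ_d = pairField dWaveFormFactor L and Δ₂(N;L) = E₀(N+2,0)+E₀(N−2,0)−2E₀(N,0)
(sector minima). Consequence: pair-field LRO at level m² forces Δ₂ ≤ C/(m²L²), i.e. the ceiling m² ≤
C(U)·κ_L with κ_L := 1/(L²Δ₂). Proof sketch: O = Δ_d + Δ_d†, Hψ = Eψ ⇒ ⟨Oψ,(H−E)Oψ⟩ =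
½⟨ψ,[[O,H],O]ψ⟩ ≤ ½‖[[O,H],O]‖ ≤ C_R(U)L² by locality (KomaTasaki1994 Thm 2.2 proof p.7; tree
horschVonDerLinden_holds — its commuting-density hypothesis hoo fails for overlapping bonds: either
split Δ_d = 2(B₁+B₂−B₃−B₄) over the four perfect matchings of the even torus (densities commute
inside one matching; SuSuzuki1998 fn. 23) and use (Σ‖B_iψ‖)² ≤ 4Σ‖B_iψ‖², or redo the locality count
with [o_x,o_y] = 0 unless supports overlap); orthogonality of the N±2 sectors gives a·‖Δ_d†ψ‖² +
b·‖Δ_dψ‖² ≤ C_R L² with a = E₀(N+2)−E₀(N), b = E₀(N−2)−E₀(N); ‖Δ_d†ψ‖² − ‖Δ_dψ‖² = ⟨[Δ_d,Δ_d†]⟩ =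
O(L²) (local commutator) and |a| ≤ 8+2 -/
@[route_item "route-HubbardSuperconductivity-PlateauExclusion"]
def PairGapCeiling : Prop :=
  ∀ U : ℝ, ∃ C : ℝ, ∀ (L N : ℕ) [NeZero L] (ψ : Literature.MathematicalPhysics.QuantumLattice.Fock (Literature.MathematicalPhysics.QuantumLattice.Orb (Literature.MathematicalPhysics.QuantumLattice.FermionTorus 2 L))), Even L → 2 ≤ N → N + 2 ≤ 2 * L ^ 2 → star ψ ⬝ᵥ ψ = 1 → Literature.MathematicalPhysics.QuantumLattice.IsGroundStateInSector (Literature.MathematicalPhysics.QuantumLattice.hubbardTorus 2 L 1 U) N 0 ψ → ((Literature.MathematicalPhysics.QuantumLattice.hubbardTorus 2 L 1 U).minEnergyOn (Literature.MathematicalPhysics.QuantumLattice.szSector (N + 2) 0) + (Literature.MathematicalPhysics.QuantumLattice.hubbardTorus 2 L 1 U).minEnergyOn (Literature.MathematicalPhysics.QuantumLattice.szSector (N - 2) 0) - 2 * (Literature.MathematicalPhysics.QuantumLattice.hubbardTorus 2 L 1 U).minEnergyOn (Literature.MathematicalPhysics.QuantumLattice.szSector N 0)) * (Literature.MathematicalPhysics.QuantumLattice.expect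 ((Literature.MathematicalPhysics.QuantumLattice.pairField Literature.MathematicalPhysics.QuantumLattice.dWaveFormFactor L)ᴴ * Literature.MathematicalPhysics.QuantumLattice.pairField Literature.MathematicalPhysics.QuantumLattice.dWaveFormFactor L) ψ).re ≤ C * (L : ℝ) ^ 2

-- earlier StripePointExclusion (stmt-HubbardSuperconductivity-1810, replaced 2026-08-15T16:34:51Z -> stmt-HubbardSuperconductivity-10962): retired by None — Literature.Barriers.HubbardSuperconductivity.PureModelStripeCompetition
/-- item stmt-HubbardSuperconductivity-10962 · support · rank 9 · open · by planner
sources: QinEtAl2020, XuEtAl2024, ArovasBergKivelsonRaghu2022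
[support] REGIONAL PAYOFF (restated rev 3, cone repair — the same Prop as before by Iff.rfl, now
spelled out): at U = 8, δ = 1/8 NOT every admissible sequence (N_L = 2⌊(7/8)L²/2⌋ at even L, ψ_L
normalised (N_L, S^z=0)-sector ground states of hubbardTorus 2 L 1 8) has d_{x²−y²} pair-field LRO
along even sides (HasLongRangeOrder of torusPullback (pairFieldCorr dWaveFormFactor ψ) (2k) over
halfOpenBox 2 (2k)) — i.e. ¬HasDWavePairFieldLROAt 8 (1/8), word for word the catalogued numerical
no-go Literature.Barriers.HubbardSuperconductivity.PureModelStripeCompetition (QinEtAl2020 §III–IV: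
filled λ = 8 stripes, Δ_∞(0) = 0.003(6); status contested — Sorella2023 vs XuEtAl2024; both Iff.rfl,
Sketch2.lean rc 0). The item no longer USES that constant nor imports its module:
PureModelStripeCompetition is a registered OPEN CONJECTURE (deliberately no `_holds`), and through
the old body `:= PureModelStripeCompetition` it sat in the route's dependency cone as
un-dischargeable named-fact debt (the staffing blocker this repair removes). Inside the route it is
reached by IncompressibilityExcludesPairing → StripePointIncompressibility → this (glue
`stripePointExclusion_of` proved in the planner's Sketc -/
@[route_item "route-HubbardSuperconductivity-PlateauExclusion"]
def StripePointExclusion : Prop :=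
  ¬ (∀ (N : ℕ → ℕ) (ψ : ∀ L, Literature.MathematicalPhysics.QuantumLattice.Fock (Literature.MathematicalPhysics.QuantumLattice.Orb (Literature.MathematicalPhysics.QuantumLattice.FermionTorus 2 L))), (∀ L, Even L → N L = 2 * ⌊(1 - 1 / 8) * (L : ℝ) ^ 2 / 2⌋₊ ∧ star (ψ L) ⬝ᵥ ψ L = 1 ∧ Literature.MathematicalPhysics.QuantumLattice.IsGroundStateInSector (Literature.MathematicalPhysics.QuantumLattice.hubbardTorus 2 L 1 8) (N L) 0 (ψ L)) → Literature.Probability.LatticeModels.HasLongRangeOrder (fun k => Literature.Probability.LatticeModels.halfOpenBox 2 (2 * k)) (fun k => Literature.MathematicalPhysics.QuantumLattice.torusPullback (Literature.MathematicalPhysics.QuantumLattice.pairFieldCorr Literature.MathematicalPhysics.QuantumLattice.dWaveFormFactor ψ) (2 * k)))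

/-- item stmt-HubbardSuperconductivity-1809 · support · rank 9 · closed · moot by None · by planner
sources: KomaTasaki1994, SuSuzuki1998, Scalapino1995
[support] SCHEMA (glue over the engine): for every U and δ ∈ (0,1), if the model is
pair-incompressible at (U,δ) along even sides (∀ C k₀ ∃ k ≥ k₀: (2k)²·Δ₂(N_{2k};2k) ≥ C, the same
inline form as the target) then EVERY admissible sequence (N_L = 2⌊(1−δ)L²/2⌋ at even L, ψ_L
normalised (N_L,S^z=0) sector ground states of hubbardTorus 2 L 1 U) has NO d-wave pair-field LRO
along even sides (the summit's HasLongRangeOrder of torusPullback (pairFieldCorr dWaveFormFactor ψ)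
(2k) over halfOpenBox 2 (2k)). Proof from PairGapCeiling: HasLongRangeOrder = 0 < liminf_k (2k)⁻⁴
Σ_{x,y∈box} G = liminf (2k)⁻⁴ re⟨ψ_{2k}, Δ_d†Δ_d ψ_{2k}⟩ (sum_pairFieldCorr_succ, torusProj
bijection on halfOpenBox); LRO ⇒ eventually y_k ≥ (c/2)(2k)⁴ ⇒ (2k)²Δ₂ ≤ 2C/c eventually (trivial
when Δ₂ < 0), contradicting incompressibility; 2 ≤ N_{2k} ≤ 2(2k)²−2 eventually for δ ∈ (0,1).
Stronger than ¬HasDWavePairFieldLROAt U δ (every sequence, not some). Bookkeeping helpers: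
Theorems/NoGoNogoThesis.lean, WeakCouplingBCSWcbcsThesis.lean (liminf_comp_pos_of_le,
pairFieldSeq_le). -/
@[route_item "route-HubbardSuperconductivity-PlateauExclusion"]
def IncompressibilityExcludesPairing : Prop :=
  ∀ (U δ : ℝ), δ ∈ Set.Ioo (0:ℝ) 1 → (∀ (C : ℝ) (k₀ : ℕ), ∃ k : ℕ, k₀ ≤ k ∧ ∀ n : ℕ, n = 2 * ⌊(1 - δ) * ((2 * k : ℕ) : ℝ) ^ 2 / 2⌋₊ → C ≤ ((2 * k : ℕ) : ℝ) ^ 2 * ((Literature.MathematicalPhysics.QuantumLattice.hubbardTorus 2 (2 * k) 1 U).minEnergyOn (Literature.MathematicalPhysics.QuantumLattice.szSector (n + 2) 0) + (Literature.MathematicalPhysics.QuantumLattice.hubbardTorus 2 (2 * k) 1 U).minEnergyOn (Literature.MathematicalPhysics.QuantumLattice.szSector (n - 2) 0) - 2 * (Literature.MathematicalPhysics.QuantumLattice.hubbardTorus 2 (2 * k) 1 U).minEnergyOn (Literature.MathematicalPhysics.QuantumLattice.szSector n 0))) → ∀ (N : ℕ → ℕ) (ψ : ∀ L, Literature.MathematicalPhysics.QuantumLattice.Fock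 (Literature.MathematicalPhysics.QuantumLattice.Orb (Literature.MathematicalPhysics.QuantumLattice.FermionTorus 2 L))), (∀ L, Even L → N L = 2 * ⌊(1 - δ) * (L : ℝ) ^ 2 / 2⌋₊ ∧ star (ψ L) ⬝ᵥ ψ L = 1 ∧ Literature.MathematicalPhysics.QuantumLattice.IsGroundStateInSector (Literature.MathematicalPhysics.QuantumLattice.hubbardTorus 2 L 1 U) (N L) 0 (ψ L)) → ¬ Literature.Probability.LatticeModels.HasLongRangeOrder (fun k => Literature.Probability.LatticeModels.halfOpenBox 2 (2 * k)) (fun k => Literature.MathematicalPhysics.QuantumLattice.torusPullback (Literature.MathematicalPhysics.QuantumLattice.pairFieldCorr Literature.MathematicalPhysics.QuantumLattice.dWaveFormFactor ψ) (2 * k))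

/-- item stmt-HubbardSuperconductivity-1811 · support · rank 9 · closed · moot by None · by planner
sources: Lieb1989, Tasaki2020
[support] ONE-PARTICLE AFFINITY/IONISATION BOUND (lemma for PairGapCeiling, of independent use): on
the L-torus with t = 1, for every U, N, M and s = ±1/2, if the sectors (N, S^z=M) and (N+1, M+s) are
both non-trivial then their minima differ by at most 4 + |U| either way: E₀(N+1,M+s) ≤ E₀(N,M) + 4 +
|U| and E₀(N,M) ≤ E₀(N+1,M+s) + 4 + |U|. Proof: Φ a sector ground state of (N,M), σ the added spin:
Σ_x ⟨c†_{xσ}Φ,(H−E)c†_{xσ}Φ⟩ = Σ_x ⟨Φ, c_{xσ}[H,c†_{xσ}]Φ⟩ = ⟨−T̂_σ⟩ + U⟨Σ_x n_{x,−σ}(1−n_{xσ})⟩ ≤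
(4 + U⁺)(L² − N_σ) (tr T = 0, ‖T‖ ≤ 4 = max degree, n_{x,−σ}(1−n_{xσ}) ≤ 1−n_{xσ}) while Σ_x
‖c†_{xσ}Φ‖² = L² − N_σ > 0, and the least Rayleigh quotient is ≥ E₀(N+1,M+s) − E₀(N,M); removal: Σ_x
⟨Φ', c†_{xσ}[H,c_{xσ}]Φ'⟩ = ⟨−T̂_σ⟩ − U⟨Σ n↑n↓⟩ ≤ (4 + U⁻)N_σ over Σ‖c_{xσ}Φ'‖² = N_σ. Hence
|E₀(N±2,0) − E₀(N,0)| ≤ 8 + 2|U| through the S^z = ±1/2 sectors. -/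
@[route_item "route-HubbardSuperconductivity-PlateauExclusion"]
def AffinityBound : Prop :=
  ∀ (U : ℝ) (L N : ℕ) (M s : ℝ), (s = 1 / 2 ∨ s = -(1 / 2)) → Literature.MathematicalPhysics.QuantumLattice.szSector (Λ := Literature.MathematicalPhysics.QuantumLattice.FermionTorus 2 L) N M ≠ ⊥ → Literature.MathematicalPhysics.QuantumLattice.szSector (Λ := Literature.MathematicalPhysics.QuantumLattice.FermionTorus 2 L) (N + 1) (M + s) ≠ ⊥ → (Literature.MathematicalPhysics.QuantumLattice.hubbardTorus 2 L 1 U).minEnergyOn (Literature.MathematicalPhysics.QuantumLattice.szSector (N + 1) (M + s)) ≤ (Literature.MathematicalPhysics.QuantumLattice.hubbardTorus 2 L 1 U).minEnergyOn (Literature.MathematicalPhysics.QuantumLattice.szSector N M) + (4 + |U|) ∧ (Literature.MathematicalPhysics.QuantumLattice.hubbardTorus 2 L 1 U).minEnergyOn (Literature.MathematicalPhysics.QuantumLattice.szSector N M) ≤ (Literature.MathematicalPhysics.QuantumLattice.hubbardTorus 2 L 1 U).minEnergyOn (Literature.MathematicalPhysics.QuantumLattice.szSector (N + 1) (M + s))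 + (4 + |U|)

/-- item stmt-HubbardSuperconductivity-1812 · assembly · rank 1 · closed · moot by None · by planner
sources: Scalapino1995
[assembly] PairGapCeiling → IncompressibilityExcludesPairing → UniversalPairIncompressibility →
¬HubbardSuperconductivity. Pure logic plus existence of admissible all-sides ground-state sequences:
PROVED by the planner in SketchGlue.lean (attached as evidence), 8 lines from
Theorems/NoGoNogoThesis.not_hubbardSuperconductivity_of_allSides and exists_groundStateInSector_seq
(δ ∈ (0,1/2) ⊂ (0,1)). The first hypothesis is logically redundant given the second (it is how the
second is proved) and is listed to display the chain. -/
@[route_item "route-HubbardSuperconductivity-PlateauExclusion"]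
def Assembly : Prop :=
  PairGapCeiling → IncompressibilityExcludesPairing → UniversalPairIncompressibility → ¬ HubbardSuperconductivity

end Summit.HubbardSuperconductivity.HubbardSuperconductivity.Theses.PlateauExclusion
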